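import Summits.Ventures.LatticeQCDFlow.Scoring.AlternantFixedWordCoefficients
import Summits.Ventures.LatticeQCDFlow.Scoring.TorusParsevalAlternant
import Summits.Ventures.LatticeQCDFlow.Scoring.TorusParsevalPairing
import Summits.Ventures.LatticeQCDFlow.Scoring.UNTraceMomentsCentralPhase
import Mathlib.GroupTheory.Perm.Fin
import HarnessLib

/-!
# The Diaconis–Shahshahani moments of a Haar unitary: `∫_{U(N)} P_σ(U) conj P_τ(U) dU = |C_{𝔖_K}(τ)| [σ ∼ τ]` (`K ≤ N`)

HONEST FRAMING: exact (Metropolis-corrected) sampling algorithms for lattice gauge theory;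
figures of merit are autocorrelation/cost numbers at stated couplings and volumes; no
continuum-physics claim.

Venture `LatticeQCDFlow` (cell pub-lqcd), sub-topic `Scoring`; FANOUT row 5 (`s0-sun-a`), GEN-23.
NEW WORK of the cell (placement rule).  P. Diaconis, M. Shahshahani, *On the eigenvalues of random
matrices*, J. Appl. Probab. 31A (1994) 49–62, Theorem 2: for a Haar unitary `U ∈ U(N)` and
`N ≥ Σ_j j a_j = Σ_j j b_j`,
`E[∏_j (tr U^j)^{a_j} conj ∏_j (tr U^j)^{b_j}] = δ_{ab} ∏_j j^{a_j} a_j!`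
— the joint moments of `(tr U, tr U², …, tr U^k)` are those of independent complex Gaussians `(√j Z_j)`.
Here in permutation form: for `σ ∈ 𝔖_K` put `P_σ(U) = ∏_{m ∈ cycleType σ} tr(U^m) · (tr U)^{K − Σ cycleType σ}`
(one factor `tr U^{|c|}` per cycle, fixed points included); then for `K ≤ N`
  **`∫_{U(N)} P_σ(U) conj(P_τ(U)) dU = |C_{𝔖_K}(τ)| · [σ ∼ τ]`** (`integral_haar_unitaryGroup_cyclePoly_mul_conj`),
`|C_{𝔖_K}(σ)| = ∏_j j^{a_j} a_j!`.  Proof: Weyl's integration formula in Bochner form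
(`integral_unitaryGroup_eq_integral_cube_complex`, `TorusParsevalPairing`), on the torus
`P_σ conj P_τ |Δ|² = G_σ(e^{iθ}) conj G_τ(e^{iθ})` with `G_σ = a_ρ F_σ` (`eval₂_fixedWordPoly`), Parseval
(`integral_cube_eval₂_mul_conj_eval₂`) and the coefficient pairing `Σ_d [x^d]G_σ [x^d]G_τ = N! |C(τ)| [σ ∼ τ]`
of `AlternantFixedWordCoefficients` (Frobenius's formula and the second orthogonality relation of `𝔖_K`).
* §1 torus bookkeeping: `trace_pow_conj_unitaryGroup`, `trace_torusPt_pow`, `eval₂_fixedWordPoly`,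
  `eval₂_alternant_mul_fixedWordPoly`, `continuous_cyclePoly`, `cyclePoly_conj`.
* §2 `integral_haar_unitaryGroup_cyclePoly_mul_conj_eq_coeff` (EVERY `N`: the Haar pairing is the coefficient
  pairing over `N!`), **`integral_haar_unitaryGroup_cyclePoly_mul_conj`** (the theorem above),
  `integral_haar_unitaryGroup_normSq_cyclePoly(_eq)` (`∫ |P_σ|² = |C(σ)| = (K−Σ cycleType)! ∏ cycleType ∏ (mult)!`),
  `integral_haar_unitaryGroup_cyclePoly_mul_conj_eq_zero` (`σ ≁ τ`).
* §3 named instances: **`integral_haar_unitaryGroup_normSq_trace_pow`** (`∫_{U(N)} |tr U^j|² dU = j`,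
  `2 ≤ j ≤ N`; with `D`'s `∫ |tr U|² = 1` this is `E|tr U^j|² = min(j, N)` on `j ≤ N`),
  `integral_haar_unitaryGroup_trace_sq_mul_conj_trace_two` (`∫ (tr U)² conj tr(U²) dU = 0`, `N ≥ 2`:
  `p_1²` and `p_2` are orthogonal).
* §4 `SU(N)`: `cyclePoly_smul` (`P_σ(cM) = c^K P_σ(M)`), **`integral_haar_specialUnitaryGroup_cyclePoly_mul_conj`**
  (the same moments on `SU(N)` via the special part, the tree's `map_specialPart_haarProbability`),
  `integral_haar_specialUnitaryGroup_normSq_trace_pow` (`∫_{SU(N)} |tr V^j|² = j`, `2 ≤ j ≤ N`).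
No `def`, nothing cited as a fact, 0 sorry.
-/

noncomputable section

open Real MeasureTheory Finset Complex Equiv
open scoped ComplexConjugate
open Literature.MathematicalPhysics.QuantumFieldTheory (haarProbability)
open Literature.RepresentationTheory.CompactGroups.WeylIntegration
open Literature.RingTheory.SymmetricFunctions.SymmPoly (alternant rho map_alternant)
open Literature.RepresentationTheory.FiniteGroups (fixedWordPoly fixedWordPoly_eq_prod_cycleType)

namespace Summit.Ventures.LatticeQCDFlow.Scoring

variable {N K : ℕ}

/-! ### 1. Torus bookkeeping -/

/-- `tr((a u a⁻¹)^m) = tr(u^m)` on `U(N)`. -/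
theorem trace_pow_conj_unitaryGroup (a u : Matrix.unitaryGroup (Fin N) ℂ) (m : ℕ) :
    ((((a * u * a⁻¹ : Matrix.unitaryGroup (Fin N) ℂ)) : Matrix (Fin N) (Fin N) ℂ) ^ m).trace
      = (((u : Matrix.unitaryGroup (Fin N) ℂ) : Matrix (Fin N) (Fin N) ℂ) ^ m).trace := by
  rw [← SubmonoidClass.coe_pow, ← SubmonoidClass.coe_pow, conj_pow, trace_conj_unitaryGroup]

/-- `tr(diag(e^{iθ})^m) = Σ_b e^{imθ_b}`. -/
theorem trace_torusPt_pow (θ : Fin N → ℝ) (m : ℕ) :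
    ((((torusPt θ : Literature.LinearAlgebra.Matrix.diagonalTorus (Fin N)) : Matrix.unitaryGroup (Fin N) ℂ) :
        Matrix (Fin N) (Fin N) ℂ) ^ m).trace = ∑ b, cexp (θ b * I) ^ m := by
  rw [coe_torusPt, Matrix.diagonal_pow, Matrix.trace_diagonal]
  rfl

/-- `F_σ(x) = ∏_{m ∈ cycleType σ} p_m(x) · p_1(x)^{K − Σ cycleType σ}` evaluated at a complex point. -/
theorem eval₂_fixedWordPoly (x : Fin N → ℂ) (σ : Perm (Fin K)) :
    MvPolynomial.eval₂ (Int.castRingHom ℂ) x (fixedWordPoly N σ)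
      = (σ.cycleType.map fun m => ∑ b, x b ^ m).prod * (∑ b, x b) ^ (K - σ.cycleType.sum) := by
  rw [fixedWordPoly_eq_prod_cycleType, MvPolynomial.eval₂_mul, MvPolynomial.eval₂_pow, Fintype.card_fin,
    ← MvPolynomial.coe_eval₂Hom, map_multiset_prod, Multiset.map_map]
  have hp : ∀ m : ℕ, MvPolynomial.eval₂Hom (Int.castRingHom ℂ) x (MvPolynomial.psum (Fin N) ℤ m) = ∑ b, x b ^ m := by
    intro m
    rw [MvPolynomial.coe_eval₂Hom, MvPolynomial.psum, MvPolynomial.eval₂_sum]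
    exact Finset.sum_congr rfl fun b _ => by rw [MvPolynomial.eval₂_pow, MvPolynomial.eval₂_X]
  have h1 : MvPolynomial.eval₂Hom (Int.castRingHom ℂ) x (MvPolynomial.psum (Fin N) ℤ 1) = ∑ b, x b := by
    rw [hp]; simp_rw [pow_one]
  rw [h1]
  congr 2
  exact Multiset.map_congr rfl fun m _ => hp m

/-- `G_σ(x) = a_ρ(x) F_σ(x)` at a complex point. -/
theorem eval₂_alternant_mul_fixedWordPoly (x : Fin N → ℂ) (σ : Perm (Fin K)) :
    MvPolynomial.eval₂ (Int.castRingHom ℂ) x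
        (alternant (fun i => (MvPolynomial.X i : MvPolynomial (Fin N) ℤ)) (rho N) * fixedWordPoly N σ)
      = alternant x (rho N) *
          ((σ.cycleType.map fun m => ∑ b, x b ^ m).prod * (∑ b, x b) ^ (K - σ.cycleType.sum)) := by
  rw [MvPolynomial.eval₂_mul, eval₂_fixedWordPoly]
  congr 1
  have h := map_alternant (MvPolynomial.eval₂Hom (Int.castRingHom ℂ) x)
    (fun i => (MvPolynomial.X i : MvPolynomial (Fin N) ℤ)) (rho N)
  rw [MvPolynomial.coe_eval₂Hom] at h
  rw [h]
  congr 1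
  funext i
  simp

/-- `P_σ(U) = ∏_{m ∈ cycleType σ} tr(U^m) · (tr U)^{K − Σ cycleType σ}` is continuous on `U(N)`. -/
theorem continuous_cyclePoly (σ : Perm (Fin K)) :
    Continuous fun u : Matrix.unitaryGroup (Fin N) ℂ =>
      (σ.cycleType.map fun m => (((u : Matrix.unitaryGroup (Fin N) ℂ) : Matrix (Fin N) (Fin N) ℂ) ^ m).trace).prod *
        ((u : Matrix.unitaryGroup (Fin N) ℂ) : Matrix (Fin N) (Fin N) ℂ).trace ^ (K - σ.cycleType.sum) :=
  (continuous_multiset_prod _ fun m _ => (continuous_subtype_val.pow m).matrix_trace).mul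
    ((continuous_id.matrix_trace.comp continuous_subtype_val).pow _)

/-- `P_σ` is a class function on `U(N)`. -/
theorem cyclePoly_conj (σ : Perm (Fin K)) (a u : Matrix.unitaryGroup (Fin N) ℂ) :
    (σ.cycleType.map fun m =>
        ((((a * u * a⁻¹ : Matrix.unitaryGroup (Fin N) ℂ)) : Matrix (Fin N) (Fin N) ℂ) ^ m).trace).prod *
        (((a * u * a⁻¹ : Matrix.unitaryGroup (Fin N) ℂ)) : Matrix (Fin N) (Fin N) ℂ).trace ^ (K - σ.cycleType.sum)
      = (σ.cycleType.map fun m => (((u : Matrix.unitaryGroup (Fin N) ℂ) : Matrix (Fin N) (Fin N) ℂ) ^ m).trace).prod *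
        ((u : Matrix.unitaryGroup (Fin N) ℂ) : Matrix (Fin N) (Fin N) ℂ).trace ^ (K - σ.cycleType.sum) := by
  simp_rw [trace_pow_conj_unitaryGroup, trace_conj_unitaryGroup]

/-! ### 2. The Diaconis–Shahshahani moments -/

/-- **The Haar pairing of `P_σ` and `P_τ` is the coefficient pairing of `G_σ` and `G_τ` over `N!`**, for EVERY `N`:
`∫_{U(N)} P_σ(U) conj(P_τ(U)) dU = (N!)⁻¹ Σ_d [x^d]G_σ [x^d]G_τ` (Weyl's formula, `P_σ conj P_τ |Δ|² = G_σ conj G_τ` on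
the torus, Parseval). -/
theorem integral_haar_unitaryGroup_cyclePoly_mul_conj_eq_coeff (σ τ : Perm (Fin K)) :
    ∫ u, ((σ.cycleType.map fun m => (((u : Matrix.unitaryGroup (Fin N) ℂ) : Matrix (Fin N) (Fin N) ℂ) ^ m).trace).prod *
          ((u : Matrix.unitaryGroup (Fin N) ℂ) : Matrix (Fin N) (Fin N) ℂ).trace ^ (K - σ.cycleType.sum)) *
        conj ((τ.cycleType.map fun m => (((u : Matrix.unitaryGroup (Fin N) ℂ) : Matrix (Fin N) (Fin N) ℂ) ^ m).trace).prod *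
          ((u : Matrix.unitaryGroup (Fin N) ℂ) : Matrix (Fin N) (Fin N) ℂ).trace ^ (K - τ.cycleType.sum))
        ∂(haarProbability (Matrix.unitaryGroup (Fin N) ℂ))
      = ((N.factorial : ℂ))⁻¹ *
          ((∑ d ∈ (alternant (fun i => (MvPolynomial.X i : MvPolynomial (Fin N) ℤ)) (rho N) * fixedWordPoly N σ).support,
              MvPolynomial.coeff d
                  (alternant (fun i => (MvPolynomial.X i : MvPolynomial (Fin N) ℤ)) (rho N) * fixedWordPoly N σ) *
                MvPolynomial.coeff d
                  (alternant (fun i => (MvPolynomial.X i : MvPolynomial (Fin N) ℤ)) (rho N) * fixedWordPoly N τ) : ℤ) : ℂ) := by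
  have hc : Continuous fun u : Matrix.unitaryGroup (Fin N) ℂ =>
      ((σ.cycleType.map fun m => (((u : Matrix.unitaryGroup (Fin N) ℂ) : Matrix (Fin N) (Fin N) ℂ) ^ m).trace).prod *
          ((u : Matrix.unitaryGroup (Fin N) ℂ) : Matrix (Fin N) (Fin N) ℂ).trace ^ (K - σ.cycleType.sum)) *
        conj ((τ.cycleType.map fun m => (((u : Matrix.unitaryGroup (Fin N) ℂ) : Matrix (Fin N) (Fin N) ℂ) ^ m).trace).prod *
          ((u : Matrix.unitaryGroup (Fin N) ℂ) : Matrix (Fin N) (Fin N) ℂ).trace ^ (K - τ.cycleType.sum)) :=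
    (continuous_cyclePoly (N := N) σ).mul (Complex.continuous_conj.comp (continuous_cyclePoly (N := N) τ))
  have hcl : ∀ a u : Matrix.unitaryGroup (Fin N) ℂ,
      ((σ.cycleType.map fun m =>
          ((((a * u * a⁻¹ : Matrix.unitaryGroup (Fin N) ℂ)) : Matrix (Fin N) (Fin N) ℂ) ^ m).trace).prod *
          (((a * u * a⁻¹ : Matrix.unitaryGroup (Fin N) ℂ)) : Matrix (Fin N) (Fin N) ℂ).trace ^ (K - σ.cycleType.sum)) *
        conj ((τ.cycleType.map fun m =>
          ((((a * u * a⁻¹ : Matrix.unitaryGroup (Fin N) ℂ)) : Matrix (Fin N) (Fin N) ℂ) ^ m).trace).prod *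
          (((a * u * a⁻¹ : Matrix.unitaryGroup (Fin N) ℂ)) : Matrix (Fin N) (Fin N) ℂ).trace ^ (K - τ.cycleType.sum))
      = ((σ.cycleType.map fun m => (((u : Matrix.unitaryGroup (Fin N) ℂ) : Matrix (Fin N) (Fin N) ℂ) ^ m).trace).prod *
          ((u : Matrix.unitaryGroup (Fin N) ℂ) : Matrix (Fin N) (Fin N) ℂ).trace ^ (K - σ.cycleType.sum)) *
        conj ((τ.cycleType.map fun m => (((u : Matrix.unitaryGroup (Fin N) ℂ) : Matrix (Fin N) (Fin N) ℂ) ^ m).trace).prod *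
          ((u : Matrix.unitaryGroup (Fin N) ℂ) : Matrix (Fin N) (Fin N) ℂ).trace ^ (K - τ.cycleType.sum)) := by
    intro a u
    rw [cyclePoly_conj, cyclePoly_conj]
  rw [integral_unitaryGroup_eq_integral_cube_complex hc hcl]
  have hθ : ∀ θ : Fin N → ℝ,
      ((σ.cycleType.map fun m =>
          ((((torusPt θ : Literature.LinearAlgebra.Matrix.diagonalTorus (Fin N)) : Matrix.unitaryGroup (Fin N) ℂ) :
            Matrix (Fin N) (Fin N) ℂ) ^ m).trace).prod *
          ((((torusPt θ : Literature.LinearAlgebra.Matrix.diagonalTorus (Fin N)) : Matrix.unitaryGroup (Fin N) ℂ) :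
            Matrix (Fin N) (Fin N) ℂ).trace) ^ (K - σ.cycleType.sum)) *
        conj ((τ.cycleType.map fun m =>
          ((((torusPt θ : Literature.LinearAlgebra.Matrix.diagonalTorus (Fin N)) : Matrix.unitaryGroup (Fin N) ℂ) :
            Matrix (Fin N) (Fin N) ℂ) ^ m).trace).prod *
          ((((torusPt θ : Literature.LinearAlgebra.Matrix.diagonalTorus (Fin N)) : Matrix.unitaryGroup (Fin N) ℂ) :
            Matrix (Fin N) (Fin N) ℂ).trace) ^ (K - τ.cycleType.sum)) *
        ((∏ p : OD (Fin N), ‖cexp (θ p.1.1 * I) - cexp (θ p.1.2 * I)‖ ^ 2 : ℝ) : ℂ)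
      = MvPolynomial.eval₂ (Int.castRingHom ℂ) (fun b => cexp (θ b * I))
          (alternant (fun i => (MvPolynomial.X i : MvPolynomial (Fin N) ℤ)) (rho N) * fixedWordPoly N σ) *
        conj (MvPolynomial.eval₂ (Int.castRingHom ℂ) (fun b => cexp (θ b * I))
          (alternant (fun i => (MvPolynomial.X i : MvPolynomial (Fin N) ℤ)) (rho N) * fixedWordPoly N τ)) := by
    intro θ
    rw [prod_OD_norm_sub_sq_eq_norm_vdm_sq, ← norm_alternant_rho_eq_norm_vdm, eval₂_alternant_mul_fixedWordPoly,
      eval₂_alternant_mul_fixedWordPoly, ← Complex.normSq_eq_norm_sq, ← Complex.mul_conj]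
    simp only [trace_torusPt_pow, trace_torusPt, map_mul, map_pow]
    ring
  simp_rw [hθ]
  rw [integral_cube_eval₂_mul_conj_eval₂]
  push_cast
  have h1 : (2 * (π : ℂ)) ^ N ≠ 0 := pow_ne_zero _ (mul_ne_zero two_ne_zero (Complex.ofReal_ne_zero.mpr Real.pi_ne_zero))
  have h2 : ((N.factorial : ℕ) : ℂ) ≠ 0 := Nat.cast_ne_zero.mpr (Nat.factorial_ne_zero _)
  rw [← mul_assoc, show ((2 * (π : ℂ)) ^ N * (N.factorial : ℂ))⁻¹ * (2 * (π : ℂ)) ^ N = ((N.factorial : ℂ))⁻¹ by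
    field_simp]

/-- **DIACONIS–SHAHSHAHANI, Theorem 2 (permutation form)**: for `σ, τ ∈ 𝔖_K` and `K ≤ N`,
`∫_{U(N)} P_σ(U) conj(P_τ(U)) dU = |C_{𝔖_K}(τ)|` if `σ` and `τ` have the same cycle type, and `0` otherwise,
where `P_σ(U) = ∏_{m ∈ cycleType σ} tr(U^m) · (tr U)^{#fixed points}`.  In the moment language: for
`N ≥ Σ j a_j = Σ j b_j`, `E[∏_j (tr U^j)^{a_j} conj ∏_j (tr U^j)^{b_j}] = δ_{ab} ∏_j j^{a_j} a_j!`. -/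
theorem integral_haar_unitaryGroup_cyclePoly_mul_conj (hK : K ≤ N) (σ τ : Perm (Fin K)) :
    ∫ u, ((σ.cycleType.map fun m => (((u : Matrix.unitaryGroup (Fin N) ℂ) : Matrix (Fin N) (Fin N) ℂ) ^ m).trace).prod *
          ((u : Matrix.unitaryGroup (Fin N) ℂ) : Matrix (Fin N) (Fin N) ℂ).trace ^ (K - σ.cycleType.sum)) *
        conj ((τ.cycleType.map fun m => (((u : Matrix.unitaryGroup (Fin N) ℂ) : Matrix (Fin N) (Fin N) ℂ) ^ m).trace).prod *
          ((u : Matrix.unitaryGroup (Fin N) ℂ) : Matrix (Fin N) (Fin N) ℂ).trace ^ (K - τ.cycleType.sum))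
        ∂(haarProbability (Matrix.unitaryGroup (Fin N) ℂ))
      = if IsConj σ τ then (Nat.card (Subgroup.centralizer ({τ} : Set (Perm (Fin K)))) : ℂ) else 0 := by
  rw [integral_haar_unitaryGroup_cyclePoly_mul_conj_eq_coeff, sum_support_coeff_mul_coeff_eq_centralizer hK, ← mul_assoc,
    inv_mul_cancel₀ (Nat.cast_ne_zero.mpr (Nat.factorial_ne_zero _)), one_mul]

/-- **`∫_{U(N)} |P_σ(U)|² dU = |C_{𝔖_K}(σ)|`** for `K ≤ N`. -/
theorem integral_haar_unitaryGroup_normSq_cyclePoly (hK : K ≤ N) (σ : Perm (Fin K)) :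
    ∫ u, ‖(σ.cycleType.map fun m => (((u : Matrix.unitaryGroup (Fin N) ℂ) : Matrix (Fin N) (Fin N) ℂ) ^ m).trace).prod *
          ((u : Matrix.unitaryGroup (Fin N) ℂ) : Matrix (Fin N) (Fin N) ℂ).trace ^ (K - σ.cycleType.sum)‖ ^ 2
        ∂(haarProbability (Matrix.unitaryGroup (Fin N) ℂ))
      = (Nat.card (Subgroup.centralizer ({σ} : Set (Perm (Fin K)))) : ℝ) := by
  have h := integral_haar_unitaryGroup_cyclePoly_mul_conj hK σ σ
  rw [if_pos (IsConj.refl σ)] at h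
  apply Complex.ofReal_injective
  rw [← integral_complex_ofReal, Complex.ofReal_natCast, ← h]
  refine integral_congr_ae (Filter.Eventually.of_forall fun u => ?_)
  dsimp only
  rw [← Complex.normSq_eq_norm_sq, ← Complex.mul_conj]

/-- **`∫_{U(N)} |P_σ(U)|² dU = (K − Σ cycleType σ)! · ∏ cycleType σ · ∏_m (mult_σ m)!`** for `K ≤ N`
(Mathlib's `Equiv.Perm.nat_card_centralizer`), i.e. `E ∏_j |tr U^j|^{2 a_j} = ∏_j j^{a_j} a_j!` for `Σ_j j a_j ≤ N`. -/
theorem integral_haar_unitaryGroup_normSq_cyclePoly_eq (hK : K ≤ N) (σ : Perm (Fin K)) :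
    ∫ u, ‖(σ.cycleType.map fun m => (((u : Matrix.unitaryGroup (Fin N) ℂ) : Matrix (Fin N) (Fin N) ℂ) ^ m).trace).prod *
          ((u : Matrix.unitaryGroup (Fin N) ℂ) : Matrix (Fin N) (Fin N) ℂ).trace ^ (K - σ.cycleType.sum)‖ ^ 2
        ∂(haarProbability (Matrix.unitaryGroup (Fin N) ℂ))
      = (((K - σ.cycleType.sum).factorial * σ.cycleType.prod *
          ∏ m ∈ σ.cycleType.toFinset, (σ.cycleType.count m).factorial : ℕ) : ℝ) := by
  rw [integral_haar_unitaryGroup_normSq_cyclePoly hK, Equiv.Perm.nat_card_centralizer, Fintype.card_fin]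

/-- **Orthogonality of distinct cycle types**: `∫_{U(N)} P_σ(U) conj(P_τ(U)) dU = 0` for `σ ≁ τ` in `𝔖_K`, `K ≤ N`. -/
theorem integral_haar_unitaryGroup_cyclePoly_mul_conj_eq_zero (hK : K ≤ N) {σ τ : Perm (Fin K)} (h : ¬ IsConj σ τ) :
    ∫ u, ((σ.cycleType.map fun m => (((u : Matrix.unitaryGroup (Fin N) ℂ) : Matrix (Fin N) (Fin N) ℂ) ^ m).trace).prod *
          ((u : Matrix.unitaryGroup (Fin N) ℂ) : Matrix (Fin N) (Fin N) ℂ).trace ^ (K - σ.cycleType.sum)) *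
        conj ((τ.cycleType.map fun m => (((u : Matrix.unitaryGroup (Fin N) ℂ) : Matrix (Fin N) (Fin N) ℂ) ^ m).trace).prod *
          ((u : Matrix.unitaryGroup (Fin N) ℂ) : Matrix (Fin N) (Fin N) ℂ).trace ^ (K - τ.cycleType.sum))
        ∂(haarProbability (Matrix.unitaryGroup (Fin N) ℂ)) = 0 := by
  rw [integral_haar_unitaryGroup_cyclePoly_mul_conj hK, if_neg h]

/-! ### 3. Named instances -/

/-- **`∫_{U(N)} |tr U^j|² dU = j` for `2 ≤ j ≤ N`** (`σ =` the `j`-cycle `finRotate j ∈ 𝔖_j`, centralizer of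
order `j`).  Together with `∫ |tr U|² = 1` this is Diaconis–Shahshahani's `E|tr U^j|² = j = min(j, N)` for `j ≤ N`. -/
theorem integral_haar_unitaryGroup_normSq_trace_pow {j : ℕ} (hj : 2 ≤ j) (hjN : j ≤ N) :
    ∫ u, ‖(((u : Matrix.unitaryGroup (Fin N) ℂ) : Matrix (Fin N) (Fin N) ℂ) ^ j).trace‖ ^ 2
        ∂(haarProbability (Matrix.unitaryGroup (Fin N) ℂ)) = j := by
  have h := integral_haar_unitaryGroup_normSq_cyclePoly_eq hjN (finRotate j)
  rw [cycleType_finRotate_of_le hj] at h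
  simp only [Multiset.map_singleton, Multiset.prod_singleton, Multiset.sum_singleton, Nat.sub_self, pow_zero,
    mul_one, Nat.factorial_zero, one_mul, Multiset.toFinset_singleton, Finset.prod_singleton,
    Multiset.count_singleton_self, Nat.factorial_one] at h
  exact h

/-- **`∫_{U(N)} (tr U)² conj(tr U²) dU = 0` for `N ≥ 2`**: the power sums `p_1²` and `p_2` are orthogonal in
`L²(U(N))` (`σ = 1`, `τ =` the transposition of `𝔖_2`, not conjugate). -/
theorem integral_haar_unitaryGroup_trace_sq_mul_conj_trace_two (hN : 2 ≤ N) :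
    ∫ u, ((u : Matrix.unitaryGroup (Fin N) ℂ) : Matrix (Fin N) (Fin N) ℂ).trace ^ 2 *
        conj ((((u : Matrix.unitaryGroup (Fin N) ℂ) : Matrix (Fin N) (Fin N) ℂ) ^ 2).trace)
        ∂(haarProbability (Matrix.unitaryGroup (Fin N) ℂ)) = 0 := by
  have hne : ¬ IsConj (1 : Perm (Fin 2)) (finRotate 2) := fun h =>
    (isCycle_finRotate_of_le le_rfl).ne_one (isConj_one_right.mp h)
  have h := integral_haar_unitaryGroup_cyclePoly_mul_conj_eq_zero hN hne
  rw [cycleType_finRotate_of_le le_rfl, Equiv.Perm.cycleType_one] at h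
  simp only [Multiset.map_singleton, Multiset.prod_singleton, Multiset.sum_singleton, Nat.sub_self, pow_zero,
    mul_one, Multiset.map_zero, Multiset.prod_zero, Multiset.sum_zero, Nat.sub_zero, one_mul] at h
  exact h

/-! ### 4. The same on `SU(N)` -/

/-- `∏_{m ∈ s} c^m = c^{Σ s}` for a multiset of exponents. -/
theorem multiset_prod_map_pow_eq_pow_sum (c : ℂ) (s : Multiset ℕ) : (s.map fun m => c ^ m).prod = c ^ s.sum := by
  induction s using Multiset.induction_on with
  | empty => simp
  | cons a s ih => rw [Multiset.map_cons, Multiset.prod_cons, Multiset.sum_cons, pow_add, ih]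

/-- Scaling the matrix scales `P_σ` by the `K`-th power: `P_σ(c M) = c^K P_σ(M)` (`P_σ` is homogeneous of
degree `Σ cycleType σ + #fixed points = K`). -/
theorem cyclePoly_smul (σ : Perm (Fin K)) (c : ℂ) (M : Matrix (Fin N) (Fin N) ℂ) :
    (σ.cycleType.map fun m => ((c • M) ^ m).trace).prod * (c • M).trace ^ (K - σ.cycleType.sum)
      = c ^ K * ((σ.cycleType.map fun m => (M ^ m).trace).prod * M.trace ^ (K - σ.cycleType.sum)) := by
  have hle : σ.cycleType.sum ≤ K := (Equiv.Perm.sum_cycleType_le σ).trans (Fintype.card_fin K).le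
  simp_rw [smul_pow, Matrix.trace_smul, smul_eq_mul, mul_pow]
  rw [Multiset.prod_map_mul, multiset_prod_map_pow_eq_pow_sum]
  have hK' : c ^ K = c ^ σ.cycleType.sum * c ^ (K - σ.cycleType.sum) := by
    rw [← pow_add, Nat.add_sub_cancel' hle]
  rw [hK']
  ring

/-- **DIACONIS–SHAHSHAHANI ON `SU(N)`**: for `σ, τ ∈ 𝔖_K`, `K ≤ N`,
`∫_{SU(N)} P_σ(V) conj(P_τ(V)) dV = |C_{𝔖_K}(τ)| · [σ ∼ τ]` — the same as on `U(N)`: the special part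
`u ↦ ζ(u)⁻¹ u` (`|ζ| = 1`) pushes Haar`_{U(N)}` to Haar`_{SU(N)}` and multiplies `P_σ conj P_τ` by `|ζ|^{−2K} = 1`. -/
theorem integral_haar_specialUnitaryGroup_cyclePoly_mul_conj (hK : K ≤ N) (σ τ : Perm (Fin K)) :
    ∫ V, ((σ.cycleType.map fun m =>
            (((V : Matrix.specialUnitaryGroup (Fin N) ℂ) : Matrix (Fin N) (Fin N) ℂ) ^ m).trace).prod *
          ((V : Matrix.specialUnitaryGroup (Fin N) ℂ) : Matrix (Fin N) (Fin N) ℂ).trace ^ (K - σ.cycleType.sum)) *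
        conj ((τ.cycleType.map fun m =>
            (((V : Matrix.specialUnitaryGroup (Fin N) ℂ) : Matrix (Fin N) (Fin N) ℂ) ^ m).trace).prod *
          ((V : Matrix.specialUnitaryGroup (Fin N) ℂ) : Matrix (Fin N) (Fin N) ℂ).trace ^ (K - τ.cycleType.sum))
        ∂(haarProbability (Matrix.specialUnitaryGroup (Fin N) ℂ))
      = if IsConj σ τ then (Nat.card (Subgroup.centralizer ({τ} : Set (Perm (Fin K)))) : ℂ) else 0 := by
  have hc : Continuous fun V : Matrix.specialUnitaryGroup (Fin N) ℂ =>
      ((σ.cycleType.map fun m =>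
            (((V : Matrix.specialUnitaryGroup (Fin N) ℂ) : Matrix (Fin N) (Fin N) ℂ) ^ m).trace).prod *
          ((V : Matrix.specialUnitaryGroup (Fin N) ℂ) : Matrix (Fin N) (Fin N) ℂ).trace ^ (K - σ.cycleType.sum)) *
        conj ((τ.cycleType.map fun m =>
            (((V : Matrix.specialUnitaryGroup (Fin N) ℂ) : Matrix (Fin N) (Fin N) ℂ) ^ m).trace).prod *
          ((V : Matrix.specialUnitaryGroup (Fin N) ℂ) : Matrix (Fin N) (Fin N) ℂ).trace ^ (K - τ.cycleType.sum)) :=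
    ((continuous_multiset_prod _ fun m _ => (continuous_subtype_val.pow m).matrix_trace).mul
      ((continuous_id.matrix_trace.comp continuous_subtype_val).pow _)).mul
      (Complex.continuous_conj.comp ((continuous_multiset_prod _ fun m _ =>
        (continuous_subtype_val.pow m).matrix_trace).mul ((continuous_id.matrix_trace.comp continuous_subtype_val).pow _)))
  rw [← integral_haar_unitaryGroup_cyclePoly_mul_conj hK σ τ, ← map_specialPart_haarProbability,
    integral_map measurable_specialPart.aemeasurable hc.aestronglyMeasurable]
  refine integral_congr_ae (Filter.Eventually.of_forall fun u => ?_)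
  dsimp only
  rw [coe_specialPart, cyclePoly_smul, cyclePoly_smul, map_mul, map_pow]
  have hζ : (detPhase ((u : Matrix.unitaryGroup (Fin N) ℂ) : Matrix (Fin N) (Fin N) ℂ))⁻¹ *
      conj (detPhase ((u : Matrix.unitaryGroup (Fin N) ℂ) : Matrix (Fin N) (Fin N) ℂ))⁻¹ = 1 := by
    rw [Complex.mul_conj, Complex.normSq_eq_norm_sq, norm_inv, norm_detPhase, inv_one, one_pow, Complex.ofReal_one]
  have hζK : (detPhase ((u : Matrix.unitaryGroup (Fin N) ℂ) : Matrix (Fin N) (Fin N) ℂ))⁻¹ ^ K *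
      conj (detPhase ((u : Matrix.unitaryGroup (Fin N) ℂ) : Matrix (Fin N) (Fin N) ℂ))⁻¹ ^ K = 1 := by
    rw [← mul_pow, hζ, one_pow]
  linear_combination ((σ.cycleType.map fun m =>
      (((u : Matrix.unitaryGroup (Fin N) ℂ) : Matrix (Fin N) (Fin N) ℂ) ^ m).trace).prod *
        ((u : Matrix.unitaryGroup (Fin N) ℂ) : Matrix (Fin N) (Fin N) ℂ).trace ^ (K - σ.cycleType.sum) *
      conj ((τ.cycleType.map fun m =>
        (((u : Matrix.unitaryGroup (Fin N) ℂ) : Matrix (Fin N) (Fin N) ℂ) ^ m).trace).prod *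
        ((u : Matrix.unitaryGroup (Fin N) ℂ) : Matrix (Fin N) (Fin N) ℂ).trace ^ (K - τ.cycleType.sum))) * hζK

/-- **`∫_{SU(N)} |tr V^j|² dV = j` for `2 ≤ j ≤ N`** (e.g. `∫_{SU(3)} |tr V²|² = 2`, `∫_{SU(3)} |tr V³|² = 3`). -/
theorem integral_haar_specialUnitaryGroup_normSq_trace_pow {j : ℕ} (hj : 2 ≤ j) (hjN : j ≤ N) :
    ∫ V, ‖(((V : Matrix.specialUnitaryGroup (Fin N) ℂ) : Matrix (Fin N) (Fin N) ℂ) ^ j).trace‖ ^ 2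
        ∂(haarProbability (Matrix.specialUnitaryGroup (Fin N) ℂ)) = j := by
  have h := integral_haar_specialUnitaryGroup_cyclePoly_mul_conj hjN (finRotate j) (finRotate j)
  rw [if_pos (IsConj.refl _), Equiv.Perm.nat_card_centralizer, Fintype.card_fin, cycleType_finRotate_of_le hj] at h
  simp only [Multiset.map_singleton, Multiset.prod_singleton, Multiset.sum_singleton, Nat.sub_self, pow_zero,
    mul_one, Nat.factorial_zero, one_mul, Multiset.toFinset_singleton, Finset.prod_singleton,
    Multiset.count_singleton_self, Nat.factorial_one] at h
  apply Complex.ofReal_injective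
  rw [← integral_complex_ofReal, Complex.ofReal_natCast, ← h]
  refine integral_congr_ae (Filter.Eventually.of_forall fun V => ?_)
  dsimp only
  rw [← Complex.normSq_eq_norm_sq, ← Complex.mul_conj]

end Summit.Ventures.LatticeQCDFlow.Scoring
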